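import Mathlib
import Summits.AtomisticToContinuum.HydrodynamicLimit.Theorems.ImplosionDichotomyDenseExcursionCavityCentreVolterra

/-!
# The smooth regular branch of a Fuchsian `2 × 2` system with exponents `0` and `−m` (for theorem T3, existence half)
# (crux `DenseExcursion`, line `sonic-cavity-renewal`, stub `stub_cavityResolventCk`)

Helper file (`--supports stmt-AtomisticToContinuum-12586`, line lead a2, stub-worker E for `stub_cavityResolventCk`,
theorem T3 `centre_regular_branch`, EXISTENCE half). Registered helper `fuchs_negInt_branch`: THE SMOOTH-CATEGORY
FROBENIUS THEOREM FOR THE REGULAR BRANCH of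

  `R·u′ = a₁₁u + a₁₂c + b₁`,  `c′ = a₂₁u + a₂₂c + b₂`,  `a₁₁(0) = −m` (`m ≥ 1` an integer),

all coefficient functions `C^∞` on `ℝ`: there is `δ > 0` (depending on the `aᵢⱼ` only) such that for all `C^∞` sources
`b₁, b₂` and every `c₀ : ℂ` the system has a solution `(u, c)` of class `C^∞` on `(−δ, δ)` — ACROSS the singular point
`R = 0` — with `c(0) = c₀`. (The residue matrix is `[[−m, a₁₂(0)], [0, 0]]`, exponents `{0, −m}`; the other solutions
are singular like `R^{−m}`.) This is the structure of the resolvent equation of the line at the centre in the signed radius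
`R = ±eˣ` (`m = 3`), where no analyticity is available.

Proof: Hadamard (`a₁₁ + m = R·α`), the integrating factor `μ = exp ∫₀ᴿ α` (so `R(μY)′ = a₁₁(μY) + μ(RY′ + mY)`), the
Volterra fixed point `u = μ·E_m[(a₁₂c + b₁)/μ]`, `c = c₀ + ∫₀ᴿ(a₂₁u + a₂₂c + b₂)` (`centre_volterra_fixed_point`), and a
bootstrap `c ∈ C^k ⇒ u ∈ C^k ⇒ c ∈ C^{k+1}` using that the Euler operator preserves `C^k` locally
(`contDiffOn_eulerOp_local`) and solves the Euler row (`euler_negInt_local`). Sources: folklore (Coddington–Levinson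
Ch. 4 §2, smooth version).
-/

noncomputable section

open Set Filter MeasureTheory intervalIntegral
open scoped Topology ContDiff

namespace Summit.AtomisticToContinuum.HydrodynamicLimit.Theorems.SonicCavityRenewal

/-- LOCAL `C^n` SMOOTHNESS OF THE EULER OPERATOR: if `h` is `C^n` on `(−δ, δ)` then so is `R ↦ ∫₀¹ t^k h(Rt) dt`
(cut-off + the global statement `contDiff_eulerOp`). [folklore] -/
theorem contDiffOn_eulerOp_local {n : ℕ∞} (k : ℕ) {h : ℝ → ℂ} {δ : ℝ} (hh : ContDiffOn ℝ n h (Ioo (-δ) δ)) :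
    ContDiffOn ℝ n (fun R => ∫ t in (0 : ℝ)..1, (t : ℂ) ^ k * h (R * t)) (Ioo (-δ) δ) := by
  intro R₀ hR₀
  have hR₀' : |R₀| < δ := abs_lt.2 hR₀
  set r : ℝ := (|R₀| + δ) / 2 with hr
  have h1 : |R₀| < r := by rw [hr]; linarith
  have h2 : r < δ := by rw [hr]; linarith
  have hr0 : 0 < r := lt_of_le_of_lt (abs_nonneg _) h1
  obtain ⟨g, hg, hgh⟩ := exists_contDiff_eq_on_Icc hr0 h2 hh
  have hev : (fun R => ∫ t in (0 : ℝ)..1, (t : ℂ) ^ k * h (R * t)) =ᶠ[𝓝 R₀]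
      fun R => ∫ t in (0 : ℝ)..1, (t : ℂ) ^ k * g (R * t) := by
    have hnhds : Ioo (-r) r ∈ 𝓝 R₀ := isOpen_Ioo.mem_nhds (by rw [mem_Ioo, ← abs_lt]; exact h1)
    filter_upwards [hnhds] with R hR
    refine integral_congr fun t ht => ?_
    rw [uIcc_of_le zero_le_one] at ht
    have hRt : R * t ∈ Icc (-r) r := by
      have hR' : |R| < r := abs_lt.2 hR
      have : |R * t| ≤ |R| := by
        rw [abs_mul, abs_of_nonneg ht.1]; exact mul_le_of_le_one_right (abs_nonneg R) ht.2
      constructor <;> linarith [(abs_le.1 (this.trans hR'.le)).1, (abs_le.1 (this.trans hR'.le)).2]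
    simp only [hgh hRt]
  exact ((contDiff_eulerOp k hg).contDiffAt.congr_of_eventuallyEq hev).contDiffWithinAt

/-- A `C^∞` PRIMITIVE: for `α` smooth, `R ↦ ∫₀ᴿ α` is smooth with derivative `α`. [folklore] -/
theorem contDiff_primitive {α : ℝ → ℂ} (hα : ContDiff ℝ ∞ α) :
    ContDiff ℝ ∞ (fun R => ∫ s in (0 : ℝ)..R, α s) ∧ ∀ R, HasDerivAt (fun R => ∫ s in (0 : ℝ)..R, α s) (α R) R := by
  have hd : ∀ R, HasDerivAt (fun R => ∫ s in (0 : ℝ)..R, α s) (α R) R := fun R =>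
    integral_hasDerivAt_right (hα.continuous.intervalIntegrable _ _) hα.continuous.aestronglyMeasurable.stronglyMeasurableAtFilter
      hα.continuous.continuousAt
  refine ⟨contDiff_infty_iff_deriv.2 ⟨fun R => (hd R).differentiableAt, ?_⟩, hd⟩
  have : deriv (fun R => ∫ s in (0 : ℝ)..R, α s) = α := funext fun R => (hd R).deriv
  rw [this]; exact hα

/-- **Registered helper `fuchs_negInt_branch`: THE SMOOTH REGULAR BRANCH OF A FUCHSIAN `2 × 2` SYSTEM WITH EXPONENTS
`0` AND `−m`.** See the module docstring. [folklore] -/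
theorem fuchs_negInt_branch : ∀ (m : ℕ) (a₁₁ a₁₂ a₂₁ a₂₂ : ℝ → ℂ), 1 ≤ m → ContDiff ℝ ∞ a₁₁ → ContDiff ℝ ∞ a₁₂ → ContDiff ℝ ∞ a₂₁ → ContDiff ℝ ∞ a₂₂ → a₁₁ 0 = -(m : ℂ) → ∃ δ : ℝ, 0 < δ ∧ ∀ (b₁ b₂ : ℝ → ℂ), ContDiff ℝ ∞ b₁ → ContDiff ℝ ∞ b₂ → ∀ c₀ : ℂ, ∃ u c : ℝ → ℂ, ContDiffOn ℝ ∞ u (Set.Ioo (-δ) δ) ∧ ContDiffOn ℝ ∞ c (Set.Ioo (-δ) δ) ∧ c 0 = c₀ ∧ (∀ R ∈ Set.Ioo (-δ) δ, (R : ℂ) * deriv u R = a₁₁ R * u R + a₁₂ R * c R + b₁ R ∧ deriv c R = a₂₁ R * u R + a₂₂ R * c R + b₂ R) ∧ ((∀ R, a₁₁ (-R) = a₁₁ R) → (∀ R, a₁₂ (-R) = a₁₂ R) → (∀ R, b₁ (-R) = b₁ R) → (∀ R, a₂₁ (-R) = -a₂₁ R) → (∀ R, a₂₂ (-R) = -a₂₂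 R) → (∀ R, b₂ (-R) = -b₂ R) → ∀ R, u (-R) = u R ∧ c (-R) = c R) := by
  intro m a₁₁ a₁₂ a₂₁ a₂₂ hm ha₁₁ ha₁₂ ha₂₁ ha₂₂ h0
  -- Hadamard: `a₁₁ + m = R·α`
  obtain ⟨α, hα, hαeq, hα0⟩ := hadamard_quotient (φ := fun R => a₁₁ R + m) (ha₁₁.add contDiff_const) (by simp [h0])
  -- the integrating factor `μ = exp ∫₀ᴿ α`
  obtain ⟨hPsm, hPd⟩ := contDiff_primitive hα
  set μ : ℝ → ℂ := fun R => Complex.exp (∫ s in (0 : ℝ)..R, α s) with hμ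
  have hμsm : ContDiff ℝ ∞ μ := Complex.contDiff_exp.comp hPsm
  have hμ0 : ∀ R, μ R ≠ 0 := fun R => Complex.exp_ne_zero _
  have hμd : ∀ R, HasDerivAt μ (α R * μ R) R := fun R => by
    have := (hPd R).cexp
    simpa [hμ, mul_comm] using this
  -- the Volterra fixed point
  obtain ⟨δ, hδ, hfix⟩ := centre_volterra_fixed_point m μ a₁₂ a₂₁ a₂₂ hm hμsm.continuous hμ0 ha₁₂.continuous
    ha₂₁.continuous ha₂₂.continuous
  refine ⟨δ, hδ, fun b₁ b₂ hb₁ hb₂ c₀ => ?_⟩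
  obtain ⟨u, c, hu_cont, hc_cont, hu, hc, hpar⟩ := hfix b₁ b₂ hb₁.continuous hb₂.continuous c₀
  have hU : IsOpen (Ioo (-δ) δ) := isOpen_Ioo
  -- the source of the Euler row and the integrand of the primitive
  set h : ℝ → ℂ := fun s => (a₁₂ s * c s + b₁ s) / μ s with hh
  set Y : ℝ → ℂ := fun R => ∫ t in (0 : ℝ)..1, (t : ℂ) ^ (m - 1) * h (R * t) with hY
  set K : ℝ → ℂ := fun s => a₂₁ s * u s + a₂₂ s * c s + b₂ s with hK
  have huY : u = fun R => μ R * Y R := funext fun R => by rw [hu R]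
  have hKc : Continuous K := ((ha₂₁.continuous.mul hu_cont).add (ha₂₂.continuous.mul hc_cont)).add hb₂.continuous
  -- the derivative of `c` on `(−δ, δ)`
  have hcd : ∀ R ∈ Ioo (-δ) δ, HasDerivAt c (K R) R := by
    intro R hR
    have hprim : HasDerivAt (fun R => c₀ + ∫ s in (0 : ℝ)..R, K s) (K R) R := by
      have := integral_hasDerivAt_right (hKc.intervalIntegrable 0 R) hKc.aestronglyMeasurable.stronglyMeasurableAtFilter
        hKc.continuousAt
      simpa using this.const_add c₀
    refine hprim.congr_of_eventuallyEq ?_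
    filter_upwards [hU.mem_nhds hR] with s hs
    exact hc s (Ioo_subset_Icc_self hs)
  -- bootstrap
  have hle : ∀ {n : ℕ∞}, ((n : ℕ∞) : WithTop ℕ∞) ≤ ∞ := fun {n} => by exact_mod_cast le_top
  have hhdef : h = fun s => (a₁₂ s * c s + b₁ s) * (μ s)⁻¹ := funext fun s => div_eq_mul_inv _ _
  have hboot : ∀ k : ℕ, ContDiffOn ℝ k c (Ioo (-δ) δ) ∧ ContDiffOn ℝ k u (Ioo (-δ) δ) := by
    have step_u : ∀ {n : ℕ∞}, ContDiffOn ℝ n c (Ioo (-δ) δ) → ContDiffOn ℝ n u (Ioo (-δ) δ) := by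
      intro n hcn
      have hhn : ContDiffOn ℝ n h (Ioo (-δ) δ) := by
        rw [hhdef]
        exact (((ha₁₂.of_le hle).contDiffOn.mul hcn).add (hb₁.of_le hle).contDiffOn).mul
          ((hμsm.of_le hle).contDiffOn.inv fun s _ => hμ0 s)
      rw [huY]
      exact (hμsm.of_le hle).contDiffOn.mul (contDiffOn_eulerOp_local (m - 1) hhn)
    intro k
    induction k with
    | zero =>
      have hc0 : ContDiffOn ℝ 0 c (Ioo (-δ) δ) := contDiffOn_zero.2 hc_cont.continuousOn
      exact ⟨by exact_mod_cast hc0, by exact_mod_cast step_u hc0⟩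
    | succ k ih =>
      obtain ⟨ihc, ihu⟩ := ih
      have hKk : ContDiffOn ℝ k K (Ioo (-δ) δ) :=
        ((((ha₂₁.of_le hle).contDiffOn.mul ihu).add ((ha₂₂.of_le hle).contDiffOn.mul ihc)).add
          (hb₂.of_le hle).contDiffOn)
      have hck : ContDiffOn ℝ ((k + 1 : ℕ) : WithTop ℕ∞) c (Ioo (-δ) δ) := by
        rw [Nat.cast_succ, contDiffOn_succ_iff_deriv_of_isOpen hU]
        refine ⟨fun R hR => (hcd R hR).differentiableAt.differentiableWithinAt,
          fun h => (WithTop.natCast_ne_top k h).elim, ?_⟩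
        exact hKk.congr fun R hR => (hcd R hR).deriv
      have hck' : ContDiffOn ℝ ((k + 1 : ℕ) : ℕ∞) c (Ioo (-δ) δ) := by exact_mod_cast hck
      exact ⟨by exact_mod_cast hck', by exact_mod_cast step_u hck'⟩
  have hcs : ContDiffOn ℝ ∞ c (Ioo (-δ) δ) := contDiffOn_infty.2 fun k => (hboot k).1
  have hus : ContDiffOn ℝ ∞ u (Ioo (-δ) δ) := contDiffOn_infty.2 fun k => (hboot k).2
  have hhs : ContDiffOn ℝ ∞ h (Ioo (-δ) δ) := by
    rw [hhdef]
    exact ((ha₁₂.contDiffOn.mul hcs).add hb₁.contDiffOn).mul (hμsm.contDiffOn.inv fun s _ => hμ0 s)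
  -- the Euler row
  obtain ⟨hYs, hYode⟩ := euler_negInt_local m δ h hm hδ hhs
  refine ⟨u, c, hus, hcs, by have := hc 0 ⟨by linarith, by linarith⟩; simpa using this, fun R hR => ⟨?_, (hcd R hR).deriv⟩,
    fun ha₁₁e ha₁₂e hb₁e ha₂₁o ha₂₂o hb₂o => hpar ?_ ha₁₂e hb₁e ha₂₁o ha₂₂o hb₂o⟩
  swap
  · -- `μ` is even: `α` is odd (`a₁₁ + m` is even), so `∫₀⁻ᴿ α = ∫₀ᴿ α`
    have hαo : ∀ t, α (-t) = -α t := by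
      intro t
      rcases eq_or_ne t 0 with rfl | ht
      · have hd : deriv (fun R => a₁₁ R + (m : ℂ)) 0 = 0 := by
          have h1 : (fun R => a₁₁ (-R) + (m : ℂ)) = fun R => a₁₁ R + (m : ℂ) := funext fun R => by rw [ha₁₁e]
          have h2 : deriv (fun R => a₁₁ (-R) + (m : ℂ)) 0 = -deriv (fun R => a₁₁ R + (m : ℂ)) (-0) :=
            deriv_comp_neg (f := fun R => a₁₁ R + (m : ℂ)) (x := 0)
          rw [h1, neg_zero] at h2
          linear_combination (1 / 2 : ℂ) * h2
        simp only [neg_zero, hα0, hd]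
      · have h1 := hαeq t
        have h2 := hαeq (-t)
        rw [ha₁₁e] at h2
        have htc : (t : ℂ) ≠ 0 := Complex.ofReal_ne_zero.2 ht
        have : (t : ℂ) * α (-t) = -((t : ℂ) * α t) := by
          have e : ((-t : ℝ) : ℂ) = -(t : ℂ) := Complex.ofReal_neg t
          rw [e] at h2
          linear_combination -h1 + h2
        field_simp at this
        linear_combination this
    intro R
    have h1 : (∫ s in (0 : ℝ)..R, α (-s)) = ∫ s in (-R)..(-0), α s := intervalIntegral.integral_comp_neg α
    rw [neg_zero] at h1
    have h2 : (∫ s in (0 : ℝ)..R, α (-s)) = -∫ s in (0 : ℝ)..R, α s := by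
      rw [show (fun s => α (-s)) = fun s => -α s from funext hαo, intervalIntegral.integral_neg]
    simp only [hμ]
    rw [intervalIntegral.integral_symm (-R) 0, ← h1, h2, neg_neg]
  have hYd : HasDerivAt Y (deriv Y R) R := ((hYs.differentiableOn (by simp)) R hR).differentiableAt (hU.mem_nhds hR) |>.hasDerivAt
  have hud : HasDerivAt u (α R * μ R * Y R + μ R * deriv Y R) R := by
    rw [huY]; exact (hμd R).mul hYd
  rw [hud.deriv]
  have e1 := hYode R hR
  have e2 : (R : ℂ) * α R = a₁₁ R + m := by simpa using (hαeq R).symm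
  have e3 : μ R * h R = a₁₂ R * c R + b₁ R := by
    simp only [hh]; field_simp [hμ0 R]
  have e4 : u R = μ R * Y R := by rw [huY]
  rw [e4]
  linear_combination (μ R * Y R) * e2 + μ R * e1 + e3

end Summit.AtomisticToContinuum.HydrodynamicLimit.Theorems.SonicCavityRenewal

end
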